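import Literature.AlgebraicGeometry.Frobenioids.DivisorMonoidCategoryTheoreticity
import HarnessLib

/-!
# Frobenioids I, Thm. 6.4 (iii) for an arbitrary `Ψ′ : (C₁^pf)^un-tr ⥲ (C₂^pf)^un-tr` — piece (G2): the two
# divisor transports are compatible through the `1`-commutative square with `Ψ^rlf`

Mochizuki, *The geometry of Frobenioids I: the general theory*, Kyushu J. Math. **62** (2008) 293–400,
Thm. 6.4 (iii) p. 114 (hypothesis: "`Ψ′ : (C₁^pf)^un-tr ⥲ (C₂^pf)^un-tr` … which is compatible … with the equivalence
`Ψ^rlf` of (ii) relative to the natural functors `(C_i^pf)^un-tr → C_i^rlf`"), proof p. 115 l. 44 – p. 116 l. 4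
(the bijection of primes induced by `Ψ′` is read against the degree of `Ψ^rlf`); the natural functors are those of
Prop. 5.3 p. 103; Div-clauses = Cor. 4.11 (iv) p. 92 ("compatible with the functors `C_i → F_{Φ_i}`").
[cite: MochizukiFrdI2008, Thm. 6.4 (iii) p.114] [cite: MochizukiFrdI2008, Cor. 4.11 (iv) p.92]
[cite: MochizukiFrdI2008, Prop. 5.3 p.103]

PROOF-ONLY (cell abc-iut, seat abc-iut-L1-d2; row «T64iii-ARBITRARY-Ψ′» piece (G2), L1-lead R129 (1); assembler
abc-iut-L1-t3, SPEC `T64-ASSEMBLIES-status.md` §SPEC; (G1) = abc-iut-L1-d1's `exists_divisorTransport_pfUntr_arith`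
letter, Ψ^rlf data = abc-iut-L6-t10's `arith_rlf_exists_transportData` letter, both consumed only at the knit).
GENERIC over abc-iut-L1-t3's `PreFrobenioidData` letter (no arithmetic input), so that it elaborates independently of
the producers: operations `S^U_i` on `U_i = (C_i^pf)^un-tr` and `S^R_i` on `R_i = C_i^rlf` over bases `D_i`, monoid
homomorphisms `ι_i : Φ_i^pf → Φ_i^rlf` (`ι₂` natural in pull-backs), the natural functors `u_i : U_i ⥤ R_i` as
BINDERS lying over `D_i` up to `β_i : u_i ⋙ Base ≅ Base` with Div-clause `Div(u_i φ) = β_i^* ι_i(Div φ)`, the Cor. 4.11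
data `(ΨBase′, E′, η′, Div-clause)` of `Ψ′` and `(ΨBase, E^rlf, η^rlf, Div-clause)` of `Ψ^rlf` as BINDERS
(`DivisorMonoidIsoOverBase`), a square `σ : Ψ′ ⋙ u₂ ≅ u₁ ⋙ Ψ^rlf`, and sharp divisor monoids `Φ₂^rlf(Y)`.

* `PreFrobenioidData.degFr_hom_eq_one_of_iso`, `isUnit_div_hom_of_iso`, `div_hom_eq_one_of_iso` — an isomorphism of
  `C` has Frobenius degree `1`, and zero divisor a unit, hence `1` over a sharp `Φ(Base A)` (Rem. 1.1.1 laws).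
* **`PreFrobenioidData.divisorTransport_square_compat`** — for every `φ : A → B` of `U₁`, with `X = Base A` and
  `m = Div(φ)`: `ι₂(E′_X(m)) = γ_A^* E^rlf_X(ι₁(m))`, where `γ_A : ΨBase′(X) ⟶ ΨBase(X)` is the EXPLICIT composite iso
  `(η′_A)⁻¹ ≫ (β₂_{Ψ′A})⁻¹ ≫ Base(σ_A) ≫ η^rlf_{u₁A} ≫ ΨBase(β₁_A)` (proof: `Div` of the naturality square of `σ` at
  `φ` via `div_comp`, the iso components having `Div = 1` and `deg_Fr = 1`; then the four Div-clauses, the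
  naturality of `ι₂`, `E^rlf` in pull-backs, and `pull_comp` / `pull_id`).
* `PreFrobenioidData.exists_baseIso_divisorTransport_compat` — the same with `γ_A` packaged as an isomorphism
  `ΨBase′(X) ≅ ΨBase(X)`, and `…_of_div_surjective` — the letter of the SPEC: if every `m ∈ Φ₁^pf(Base A)` is
  `Div(φ)` for some `φ` out of `A` (Def. 1.3 (ii) at `(C₁^pf)^un-tr`), then `∃ γ, ∀ m, ι₂(E′_X m) = γ^* E^rlf_X(ι₁ m)`.
Nothing here is specific to the abc programme; no side taken on [IUTchIII] Cor. 3.12.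
-/

namespace Literature.AlgebraicGeometry.Frobenioids

namespace PreFrobenioidData

open CategoryTheory

/-! ### Isomorphisms have Frobenius degree `1` and trivial zero divisor -/

section Iso

variable {C : Type*} [Category C] {D : Type*} [Category D] (S : PreFrobenioidData C D)

/-- An isomorphism is linear: `deg_Fr(f) = 1` (`deg_Fr` is multiplicative and `deg_Fr(id) = 1`, Rem. 1.1.1).
[cite: MochizukiFrdI2008, Rem. 1.1.1 p.21] -/
theorem degFr_hom_eq_one_of_iso {A B : C} (f : A ≅ B) : S.degFr f.hom = 1 := by
  have h := S.degFr_comp f.hom f.inv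
  rw [f.hom_inv_id, S.degFr_id] at h
  have h' : (S.degFr f.hom : ℕ) * (S.degFr f.inv : ℕ) = 1 := by rw [← PNat.mul_coe, ← h, PNat.one_coe]
  exact PNat.coe_eq_one_iff.mp (mul_eq_one.mp h').1

/-- The inverse of an isomorphism is linear. [cite: MochizukiFrdI2008, Rem. 1.1.1 p.21] -/
theorem degFr_inv_eq_one_of_iso {A B : C} (f : A ≅ B) : S.degFr f.inv = 1 :=
  S.degFr_hom_eq_one_of_iso f.symm

/-- The zero divisor of an isomorphism is a unit of `Φ(Base A)` (`Div(id) = 0` and the composite law, Rem. 1.1.1).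
[cite: MochizukiFrdI2008, Rem. 1.1.1 p.21] -/
theorem isUnit_div_hom_of_iso {A B : C} (f : A ≅ B) : IsUnit (S.div f.hom) := by
  have h := S.div_comp f.hom f.inv
  rw [f.hom_inv_id, S.div_id, S.degFr_inv_eq_one_of_iso, PNat.one_coe, pow_one, mul_comm] at h
  exact isUnit_iff_exists_inv.mpr ⟨_, h.symm⟩

/-- Over a SHARP divisor monoid `Φ(Base A)` an isomorphism is an isometry: `Div(f) = 0`.
[cite: MochizukiFrdI2008, Rem. 1.1.1 p.21] -/
theorem div_hom_eq_one_of_iso {A B : C} (hsharp : IsSharp (S.Mon (S.base.obj A))) (f : A ≅ B) :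
    S.div f.hom = 1 :=
  hsharp.eq_one_of_isUnit _ (S.isUnit_div_hom_of_iso f)

end Iso

/-! ### (G2): compatibility of the divisor transports of `Ψ′` and `Ψ^rlf` through the square -/

section Square

variable {U₁ : Type*} [Category U₁] {U₂ : Type*} [Category U₂] {R₁ : Type*} [Category R₁] {R₂ : Type*} [Category R₂]
  {D₁ : Type*} [Category D₁] {D₂ : Type*} [Category D₂]
  (SU₁ : PreFrobenioidData U₁ D₁) (SU₂ : PreFrobenioidData U₂ D₂)
  (SR₁ : PreFrobenioidData R₁ D₁) (SR₂ : PreFrobenioidData R₂ D₂)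
  -- `ι_i : Φ_i^pf → Φ_i^rlf` (monoid homomorphisms on `D_i`; `ι₂` natural in pull-backs)
  (ι₁ : ∀ X : D₁, SU₁.Mon X →* SR₁.Mon X) (ι₂ : ∀ X : D₂, SU₂.Mon X →* SR₂.Mon X)
  (hι₂ : ∀ ⦃X Y : D₂⦄ (f : Y ⟶ X) (m : SU₂.Mon X), ι₂ Y (SU₂.pull f m) = SR₂.pull f (ι₂ X m))
  -- the natural functors `u_i : (C_i^pf)^un-tr → C_i^rlf`, over `D_i` up to `β_i`, with their Div-clauses
  (u₁ : U₁ ⥤ R₁) (β₁ : u₁ ⋙ SR₁.base ≅ SU₁.base)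
  (hu₁ : ∀ ⦃A B : U₁⦄ (φ : A ⟶ B), SR₁.div (u₁.map φ) = SR₁.pull (β₁.hom.app A) (ι₁ _ (SU₁.div φ)))
  (u₂ : U₂ ⥤ R₂) (β₂ : u₂ ⋙ SR₂.base ≅ SU₂.base)
  (hu₂ : ∀ ⦃A B : U₂⦄ (φ : A ⟶ B), SR₂.div (u₂.map φ) = SR₂.pull (β₂.hom.app A) (ι₂ _ (SU₂.div φ)))
  -- `Ψ′` with its Cor. 4.11 data `(ΨBase′, E′, η′)` and Div-clause
  (Ψ' : U₁ ⥤ U₂) (ΨB' : D₁ ⥤ D₂) (E' : DivisorMonoidIsoOverBase SU₁ SU₂ ΨB') (η' : Ψ' ⋙ SU₂.base ≅ SU₁.base ⋙ ΨB')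
  (hΨ' : ∀ ⦃A B : U₁⦄ (φ : A ⟶ B), SU₂.div (Ψ'.map φ) = SU₂.pull (η'.hom.app A) (E'.iso _ (SU₁.div φ)))
  -- `Ψ^rlf` with its Cor. 4.11 data `(ΨBase, E^rlf, η^rlf)` and Div-clause
  (Ψr : R₁ ⥤ R₂) (ΨB : D₁ ⥤ D₂) (Er : DivisorMonoidIsoOverBase SR₁ SR₂ ΨB) (ηr : Ψr ⋙ SR₂.base ≅ SR₁.base ⋙ ΨB)
  (hΨr : ∀ ⦃P Q : R₁⦄ (ψ : P ⟶ Q), SR₂.div (Ψr.map ψ) = SR₂.pull (ηr.hom.app P) (Er.iso _ (SR₁.div ψ)))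
  -- the `1`-commutative square and sharpness of `Φ₂^rlf`
  (σ : Ψ' ⋙ u₂ ≅ u₁ ⋙ Ψr) (hsharp : ∀ Y : D₂, IsSharp (SR₂.Mon Y))

include hι₂ hu₁ hu₂ hΨ' hΨr hsharp

/-- **(G2) The divisor transports of `Ψ′` and `Ψ^rlf` agree through the square**, with the explicit base
isomorphism `γ_A = (η′_A)⁻¹ ≫ (β₂_{Ψ′A})⁻¹ ≫ Base(σ_A) ≫ η^rlf_{u₁A} ≫ ΨBase(β₁_A) : ΨBase′(X) ⟶ ΨBase(X)`,
`X = Base A`: for every `φ : A → B` of `(C₁^pf)^un-tr`, `ι₂(E′_X(Div φ)) = γ_A^*(E^rlf_X(ι₁(Div φ)))`.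
[cite: MochizukiFrdI2008, Thm. 6.4 (iii) p.114] [cite: MochizukiFrdI2008, Cor. 4.11 (iv) p.92] -/
theorem divisorTransport_square_compat {A B : U₁} (φ : A ⟶ B) :
    ι₂ _ (E'.iso (SU₁.base.obj A) (SU₁.div φ)) =
      SR₂.pull (η'.inv.app A ≫ β₂.inv.app (Ψ'.obj A) ≫ SR₂.base.map (σ.hom.app A) ≫
          ηr.hom.app (u₁.obj A) ≫ ΨB.map (β₁.hom.app A))
        (Er.iso (SU₁.base.obj A) (ι₁ _ (SU₁.div φ))) := by
  -- the components of `σ` are isomorphisms: `Div = 0`, `deg_Fr = 1`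
  have hσA : SR₂.div (σ.hom.app A) = 1 := SR₂.div_hom_eq_one_of_iso (hsharp _) (σ.app A)
  have hσB : SR₂.div (σ.hom.app B) = 1 := SR₂.div_hom_eq_one_of_iso (hsharp _) (σ.app B)
  have hdB : SR₂.degFr (σ.hom.app B) = 1 := SR₂.degFr_hom_eq_one_of_iso (σ.app B)
  -- `Div` of the naturality square of `σ` at `φ`: `Div(u₂ Ψ′ φ) = Base(σ_A)^* Div(Ψ^rlf u₁ φ)`
  have hdiv := congrArg SR₂.div (σ.hom.naturality φ)
  rw [SR₂.div_comp, SR₂.div_comp, hσB, hσA, hdB, map_one, one_mul, PNat.one_coe, pow_one, one_pow,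
    mul_one] at hdiv
  have hdiv' : SR₂.div (u₂.map (Ψ'.map φ)) = SR₂.pull (SR₂.base.map (σ.hom.app A)) (SR₂.div (Ψr.map (u₁.map φ))) :=
    hdiv
  /- Both sides through the Div-clauses and the naturality of `ι₂`, `E^rlf` in pull-backs.  (The terms mix
     `(F ⋙ G).obj` with `G.obj (F.obj ·)`, equal by `rfl` but not syntactically, so the chain is assembled with
     `Eq.trans` / `congrArg` rather than `rw`.) -/
  have hL : SR₂.div (u₂.map (Ψ'.map φ)) =
      SR₂.pull (β₂.hom.app (Ψ'.obj A) ≫ η'.hom.app A) (ι₂ _ (E'.iso (SU₁.base.obj A) (SU₁.div φ))) := by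
    refine (hu₂ (Ψ'.map φ)).trans ?_
    refine (congrArg (fun x => SR₂.pull (β₂.hom.app (Ψ'.obj A)) (ι₂ _ x)) (hΨ' φ)).trans ?_
    refine (congrArg (fun x => SR₂.pull (β₂.hom.app (Ψ'.obj A)) x) (hι₂ (η'.hom.app A) _)).trans ?_
    exact (SR₂.pull_comp _ _ _).symm
  have hR : SR₂.div (Ψr.map (u₁.map φ)) =
      SR₂.pull (ηr.hom.app (u₁.obj A) ≫ ΨB.map (β₁.hom.app A)) (Er.iso (SU₁.base.obj A) (ι₁ _ (SU₁.div φ))) := by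
    refine (hΨr (u₁.map φ)).trans ?_
    refine (congrArg (fun x => SR₂.pull (ηr.hom.app (u₁.obj A)) (Er.iso _ x)) (hu₁ φ)).trans ?_
    refine (congrArg (fun x => SR₂.pull (ηr.hom.app (u₁.obj A)) x) (Er.natural (β₁.hom.app A) _)).trans ?_
    exact (SR₂.pull_comp _ _ _).symm
  have key : SR₂.pull (β₂.hom.app (Ψ'.obj A) ≫ η'.hom.app A) (ι₂ _ (E'.iso (SU₁.base.obj A) (SU₁.div φ))) =
      SR₂.pull (SR₂.base.map (σ.hom.app A) ≫ ηr.hom.app (u₁.obj A) ≫ ΨB.map (β₁.hom.app A))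
        (Er.iso (SU₁.base.obj A) (ι₁ _ (SU₁.div φ))) := by
    refine hL.symm.trans (hdiv'.trans ?_)
    refine (congrArg (fun x => SR₂.pull (SR₂.base.map (σ.hom.app A)) x) hR).trans ?_
    exact (SR₂.pull_comp _ _ _).symm
  -- cancel the isomorphism `β₂ ≫ η′` on the left
  have hcancel : (η'.inv.app A ≫ β₂.inv.app (Ψ'.obj A)) ≫ (β₂.hom.app (Ψ'.obj A) ≫ η'.hom.app A) = 𝟙 _ :=
    (β₂.app (Ψ'.obj A) ≪≫ η'.app A).inv_hom_id
  have hback : ι₂ _ (E'.iso (SU₁.base.obj A) (SU₁.div φ)) =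
      SR₂.pull (η'.inv.app A ≫ β₂.inv.app (Ψ'.obj A))
        (SR₂.pull (β₂.hom.app (Ψ'.obj A) ≫ η'.hom.app A) (ι₂ _ (E'.iso (SU₁.base.obj A) (SU₁.div φ)))) :=
    ((SR₂.pull_id _ _).symm.trans
      (congrArg (fun f => SR₂.pull f (ι₂ _ (E'.iso (SU₁.base.obj A) (SU₁.div φ)))) hcancel.symm)).trans
      (SR₂.pull_comp _ _ _)
  refine hback.trans ?_
  refine (congrArg (fun x => SR₂.pull (η'.inv.app A ≫ β₂.inv.app (Ψ'.obj A)) x) key).trans ?_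
  refine (SR₂.pull_comp _ _ _).symm.trans ?_
  exact congrArg (fun f => SR₂.pull f (Er.iso (SU₁.base.obj A) (ι₁ _ (SU₁.div φ))))
    (by simp only [Category.assoc]; rfl)

/-- **(G2), packaged**: the base isomorphism `γ_A : ΨBase′(Base A) ≅ ΨBase(Base A)` through the square with
`ι₂ ∘ E′ = γ_A^* ∘ E^rlf ∘ ι₁` on all zero divisors of arrows out of `A`. [cite: MochizukiFrdI2008, Thm. 6.4 (iii) p.114] -/
theorem exists_baseIso_divisorTransport_compat (A : U₁) :
    ∃ γ : ΨB'.obj (SU₁.base.obj A) ≅ ΨB.obj (SU₁.base.obj A),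
      γ.hom = η'.inv.app A ≫ β₂.inv.app (Ψ'.obj A) ≫ SR₂.base.map (σ.hom.app A) ≫
          ηr.hom.app (u₁.obj A) ≫ ΨB.map (β₁.hom.app A) ∧
      ∀ ⦃B : U₁⦄ (φ : A ⟶ B),
        ι₂ _ (E'.iso (SU₁.base.obj A) (SU₁.div φ)) = SR₂.pull γ.hom (Er.iso (SU₁.base.obj A) (ι₁ _ (SU₁.div φ))) := by
  refine ⟨(η'.app A).symm ≪≫ (β₂.app (Ψ'.obj A)).symm ≪≫ SR₂.base.mapIso (σ.app A) ≪≫ ηr.app (u₁.obj A) ≪≫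
      ΨB.mapIso (β₁.app A), ?_, fun B φ => ?_⟩
  · simp only [Iso.trans_hom, Iso.symm_hom, Iso.app_hom, Iso.app_inv, Functor.mapIso_hom]
    rfl
  · refine (divisorTransport_square_compat SU₁ SU₂ SR₁ SR₂ ι₁ ι₂ hι₂ u₁ β₁ hu₁ u₂ β₂ hu₂ Ψ' ΨB' E' η' hΨ' Ψr ΨB Er
      ηr hΨr σ hsharp φ).trans ?_
    exact congrArg (fun f => SR₂.pull f (Er.iso (SU₁.base.obj A) (ι₁ _ (SU₁.div φ))))
      (by simp only [Iso.trans_hom, Iso.symm_hom, Iso.app_hom, Iso.app_inv, Functor.mapIso_hom]; rfl)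

/-- **(G2) in the SPEC's letter**: if every `m ∈ Φ₁^pf(Base A)` is the zero divisor of some arrow out of `A`
(Def. 1.3 (ii) at `(C₁^pf)^un-tr`), then `∃ γ : ΨBase′(X) ≅ ΨBase(X)`, `X = Base A`, with
`ι₂(E′_X m) = γ^*(E^rlf_X(ι₁ m))` for ALL `m ∈ Φ₁^pf(X)`. [cite: MochizukiFrdI2008, Thm. 6.4 (iii) p.114] -/
theorem exists_baseIso_divisorTransport_compat_of_div_surjective (A : U₁)
    (hgen : ∀ m : SU₁.Mon (SU₁.base.obj A), ∃ (B : U₁) (φ : A ⟶ B), SU₁.div φ = m) :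
    ∃ γ : ΨB'.obj (SU₁.base.obj A) ≅ ΨB.obj (SU₁.base.obj A),
      γ.hom = η'.inv.app A ≫ β₂.inv.app (Ψ'.obj A) ≫ SR₂.base.map (σ.hom.app A) ≫
          ηr.hom.app (u₁.obj A) ≫ ΨB.map (β₁.hom.app A) ∧
      ∀ m : SU₁.Mon (SU₁.base.obj A),
        ι₂ _ (E'.iso (SU₁.base.obj A) m) = SR₂.pull γ.hom (Er.iso (SU₁.base.obj A) (ι₁ _ m)) := by
  obtain ⟨γ, hγ, h⟩ := exists_baseIso_divisorTransport_compat SU₁ SU₂ SR₁ SR₂ ι₁ ι₂ hι₂ u₁ β₁ hu₁ u₂ β₂ hu₂ Ψ' ΨB'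
    E' η' hΨ' Ψr ΨB Er ηr hΨr σ hsharp A
  refine ⟨γ, hγ, fun m => ?_⟩
  obtain ⟨B, φ, rfl⟩ := hgen m
  exact h φ

end Square

end PreFrobenioidData

end Literature.AlgebraicGeometry.Frobenioids
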